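import Mathlib.Geometry.Euclidean.Volume.Measure
import Mathlib.MeasureTheory.Integral.Bochner.Basic
import Mathlib.MeasureTheory.Integral.Bochner.Set
import Mathlib.LinearAlgebra.Matrix.NonsingularInverse
import Mathlib.Analysis.Normed.Affine.Isometry
import Literature.Geometry.Lorentzian.KerrSchild
import Literature.Geometry.Lorentzian.CoordCurvature
import Literature.MeasureTheory.Hausdorff.SphereHausdorffFinite
import HarnessLib

/-!
# The Landau–Lifshitz superpotential, energy–momentum pseudotensor and quasi-local
# four-momentum and angular four-momentum on coordinate spheres

Coordinate (chart) objects of Landau–Lifshitz, *The Classical Theory of Fields*, §96, for a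
metric given — as everywhere in the Kerr–Schild / convergence files of this directory
(`ModelBackground.bilin`, `Spacetime.deviationExtend`, `MetricCoord`) — by its components in ONE
global chart of `E4 = ℝ⁴`: a field `g : E4 → (E4 →L[ℝ] E4 →L[ℝ] ℝ)` of bilinear forms (only its
values on the open set where it is a smooth Lorentzian metric are meaningful; every definition
below is local in `x`, so a total function with junk values elsewhere is harmless). Index `0` is
the lab time, `1, 2, 3` are spatial (`Basic.lean`), `∂_μ` is the Fréchet derivative in the
direction `E4.basisVector μ`, and units are `c = k = 1` (LL write `c⁴/16πk`).

* `gram g x` — the matrix `(g_{μν}(x))`, `g_{μν} = g_x(∂_μ, ∂_ν)`; `metricDet g x = g = det (g_{μν})`;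
  `upper g x = (g^{μν}(x)) = (g_{μν})⁻¹` (matrix inverse); `gothic g x μ ν = 𝔤^{μν} = √(−g) g^{μν}`
  (LL §96, after (96.9); Blanchet LRR, (49)).
* `superpotential g x μ α ν β = H^{μανβ} = (−g)(g^{μν} g^{αβ} − g^{αν} g^{μβ})`, which equals
  `𝔤^{μν}𝔤^{αβ} − 𝔤^{αν}𝔤^{μβ}` wherever `g ≤ 0` (`superpotential_eq_gothic`) and is `16π` times
  LL's `λ^{μνβα}` of (96.3) (`lambdaLL`, `lambdaLL_eq`). It is antisymmetric in `(μ, α)` and in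
  `(ν, β)` *identically* (`superpotential_swap_left/right`).
* `hField g x μ ν α = h^{μνα} = ∂_β λ^{μναβ} = (16π)⁻¹ Σ_β ∂_β H^{μβνα}` (LL (96.2)), antisymmetric
  in `(ν, α)` identically (`hField_swap`, LL (96.4)).
* `emComplex g x μ ν = Σ_α ∂_α h^{μνα} = (16π)⁻¹ Σ_{αβ} ∂_α ∂_β H^{μανβ}` — the Landau–Lifshitz
  energy–momentum COMPLEX, which LL (96.5)/(96.7) write `(−g)(T^{μν} + t^{μν})`.
* `einsteinUpper g x μ ν = G^{μν}` (contravariant Einstein tensor of the components, through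
  `MetricCoord.ricAt` of `CoordCurvature.lean`), and the **Landau–Lifshitz pseudotensor**
  `pseudotensor g x μ ν = t^{μν}_LL := (−g)⁻¹ Σ_α ∂_α h^{μνα} − G^{μν}/(8π)` — this IS the definition
  (96.5)–(96.7) of LL (with `T^{μν} = G^{μν}/8π` substituted, (96.7)); the explicit quadratic
  expressions (96.8)/(96.9) are theorems about it, not restated here.
* `quasiLocalMomentum g t ξ R μ = P^μ(t; ξ, R) = ∮_{|y−ξ|=R} Σ_j h^{μ0j}(t, y) (y−ξ)_j/R dσ(y)`
  (LL (96.16): `P^i = ∮ h^{i0α} df_α`, over the coordinate sphere of radius `R` about `ξ ∈ E3` in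
  the slice `{x⁰ = t}`, `σ = μHE[2]` the Euclidean surface measure as in `admEnergyFlux`), i.e.
  `(16π)⁻¹ ∮ Σ_α ∂_α H^{μα0j} n_j dσ`; and the **momentum flux**
  `momentumFlux g t ξ R μ = Φ^μ = ∮ Σ_j (−g) t^{μj}_LL (y−ξ)_j/R dσ`.
* `amSuperpotential g a x μ ν λ α = Ψ_a^{μν|λα} = (x−a)^μ h^{νλα} − (x−a)^ν h^{μλα} + λ^{μλαν}` and
  `amComplex g a x μ ν λ = (x−a)^μ τ^{νλ} − (x−a)^ν τ^{μλ}` (`τ = emComplex`), the superpotential and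
  the complex of ANGULAR four-momentum about a reference event `a ∈ E4` (LL (96.13), derivation of
  (96.17)); the six remaining Poincaré charges of a coordinate sphere as SUPERPOTENTIAL SURFACE
  INTEGRALS `angularMomentumChargeAbout g a t ξ R μ ν = M_a^{μν} = ∮ Σ_k Ψ_a^{μν|0k}(t, y) (y−ξ)_k/R dσ`
  (LL (96.17): `M^{ik} = ∮ (x^i h^{k0α} − x^k h^{i0α} + λ^{i0αk}) df_α`, printed with `a = 0`), their
  fluxes `angularMomentumFluxAbout g a t ξ R μ ν = ∮ Σ_k amComplex^{μνk} n_k dσ`, and the CENTRED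
  versions `angularMomentumCharge g t ξ R μ ν`, `angularMomentumFlux g t ξ R μ ν` (reference event =
  the centre `(t, ξ)` of the sphere, lever arm `(0, y − ξ)`: spin and mass dipole about the centre).

With these, LL's conservation law (96.10) `∂_ν[(−g)(T^{μν} + t^{μν})] = 0` is the identity
`Σ_ν ∂_ν emComplex^{μν} = 0` (antisymmetry of `h` plus symmetry of second derivatives), and the
balance law on a sphere surrounded by vacuum reads `d/dt P^μ = −Φ^μ` (there `G = 0`, so
`(−g) t_LL = emComplex`, and `∮ Σ_m ∂_m h^{μjm} n_j = 0` for the spatial curl). Neither is proved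
in this file (they are items of route `EIHFluxBalance`); proved here are the algebraic
symmetries, the gothic form, and the vanishing of `h`, the complex, `G`, `t_LL`, `P` and `Φ` for
constant components (LL §96: "in galilean coordinates `t^{ik} = 0`"), in particular for
`Minkowski.bilin`. For the angular four-momentum: the antisymmetries `Ψ^{μν|αλ} = −Ψ^{μν|λα}`
(identically) and `Ψ^{νμ|λα} = −Ψ^{μν|λα}`, `M^{νμ} = −M^{μν}` (symmetric components), the change of
reference event `M_a^{μν} = M_b^{μν} − (a−b)^μ P^ν + (a−b)^ν P^μ` (integrable, e.g. continuous,
integrands), finiteness of `μHE[2]` on coordinate spheres, the vanishing of sphere integrals of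
reflection-odd integrands, and `M = Φ = 0` for constant components / Minkowski. The flux law
`d/dt M_a^{μν}(S_R) = −∮ Σ_k amComplex^{μνk} n_k dσ` (fixed `a`, `ξ`, `R`; every smooth metric) is
NOT proved here.

## Design choices

* **Matrices for components.** `g_{μν}`, `g^{μν}`, `g` are a `Matrix (Fin 4) (Fin 4) ℝ`, its
  `Matrix.inv` (junk `0` when singular) and `Matrix.det`, in the basis `E4.basisVector`; the
  bridge to `MetricCoord.ginv` (`CoordCurvature.lean`) is the standard "`g^{ij}` is the inverse
  Gram matrix" (`MetricCoord.ginv_eq_inv` in `LaplaceBeltramiChartForm.lean`, not imported here to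
  keep the import cone small).
* **`H` through `(−g) g g`, not `𝔤 𝔤`.** LL (96.3) has the factor `(−g)`; the product of two gothic
  factors reproduces it only where `−g ≥ 0`. The polynomial form is smooth wherever the components
  are smooth and nondegenerate, with no sign condition, and agrees with the requested
  `𝔤^{μν}𝔤^{αβ} − 𝔤^{αν}𝔤^{μβ}` on Lorentzian metrics (`superpotential_eq_gothic`).
* **Index placement in `P^μ`.** The printed sources agree: LL (96.16) `P^i = ∮ h^{i0α} df_α` with
  `h^{i0α} = ∂_m λ^{i0αm}`, i.e. `(16π)⁻¹ ∮ ∂_m H^{im0α} n_α` (the derivative index is the partner of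
  the free index `i` in the first antisymmetric pair, the normal index the partner of `0` in the
  second; the same as Misner–Thorne–Wheeler (20.9)). The definition request wrote the integrand as
  `∂_β H^{ν0kβ} n_k`; by the antisymmetry of `H` in its last pair that expression is
  `∂_0 H^{ν0k0} n_k` plus the flux of a spatial curl, hence a total time derivative that vanishes on
  every stationary metric — it cannot be the four-momentum (it gives `0`, not `M`, for
  Schwarzschild), so we follow the printed (96.16).
* **Reference event of `M^{μν}`.** LL (96.13)/(96.17) measure lever arms from the chart origin;
  the definition request asked for "coordinates relative to the centre `(t, ξ)`". Both are instances of
  `angularMomentumChargeAbout g a` (`a = 0`, resp. `a = (t, ξ)` — the latter is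
  `angularMomentumCharge`), and `M_a = M_b − (a − b) ∧ P` exactly, at the level of the surface
  integrals. The flux law has its clean form `dM_a/dt = −∮ amComplex_a n` for a FIXED event `a`; for
  the centred charge along a slicing (`a = (t, ξ)` moving with `t`) it acquires `−δ^μ_0 P^ν + δ^ν_0 P^μ`
  ("`d/dt`(mass dipole) `= P`"). The request's `λ`-term `H^{μ0kν} − H^{ν0kμ}` equals `−H^{μν0k} =
  −16π λ^{μ0kν}` by the cyclic identity of `H`, i.e. the printed term up to the sign fixed by (96.17);
  its `P`-part `∂_β H^{ν0kβ}` is replaced by the printed `h^{ν0k}` for the reason given above.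
* Not here: the explicit forms (96.8)/(96.9), the conservation law (96.10), the balance laws for `P`
  and `M`, and the evaluations `P^0 = M`, `M^{12} = Ma` of §105 / §104 for Kerr.

## References

* L. D. Landau, E. M. Lifshitz, *The Classical Theory of Fields*, 4th English ed., Pergamon 1975,
  §96, eqs. (96.2)–(96.17), and §32 (angular momentum of fields) (key `LandauLifshitz1975`).
* L. Blanchet, *Post-Newtonian theory for gravitational waves*, Living Rev. Relativ. (2014/2024),
  arXiv:1310.1528, §2.1, eqs. (49)–(54) (key `Blanchet2024`).
* C. W. Misner, K. S. Thorne, J. A. Wheeler, *Gravitation*, 1973, §20.2, (20.6)–(20.9) (flux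
  integrals for `P^μ` and `J^{μν}`) and §20.3, (20.18)–(20.23) (key `MisnerThorneWheeler1973`).
-/

noncomputable section

open TopologicalSpace Filter
open _root_.MeasureTheory
open scoped Topology ContDiff Matrix

namespace Literature.Geometry.Lorentzian

namespace LandauLifshitz

variable (g : E4 → E4 →L[ℝ] E4 →L[ℝ] ℝ)

/-! ### Components, determinant, inverse and gothic inverse -/

/-- The coordinate partial derivative `∂_μ f (x) = Df(x)(∂_μ)` of a real function on `E4`
(Fréchet derivative on the coordinate vector `E4.basisVector μ`; junk `0` where `f` is not
differentiable). LL §96 write `f_{,μ}`. [folklore] -/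
def partialDeriv (μ : Fin 4) (f : E4 → ℝ) (x : E4) : ℝ :=
  fderiv ℝ f x (E4.basisVector μ)

/-- Unfolding lemma for `partialDeriv`. [folklore] -/
theorem partialDeriv_apply (μ : Fin 4) (f : E4 → ℝ) (x : E4) :
    partialDeriv μ f x = fderiv ℝ f x (E4.basisVector μ) := rfl

/-- The **metric components** `g_{μν}(x) = g_x(∂_μ, ∂_ν)` as a `4 × 4` real matrix (LL §96 work
throughout with the components `g_{ik}` in one coordinate system). [cite: LandauLifshitz1975, §96] -/
def gram (x : E4) : Matrix (Fin 4) (Fin 4) ℝ :=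
  Matrix.of fun μ ν ↦ g x (E4.basisVector μ) (E4.basisVector ν)

/-- Unfolding lemma: `gram g x μ ν = g_x(∂_μ, ∂_ν)`. [folklore] -/
@[simp]
theorem gram_apply (x : E4) (μ ν : Fin 4) :
    gram g x μ ν = g x (E4.basisVector μ) (E4.basisVector ν) := rfl

/-- The **determinant** `g = det (g_{μν})` of the metric components (negative for a Lorentzian
metric). LL §96, the factor `(−g)` of (96.3). [cite: LandauLifshitz1975, §96 (96.3)] -/
def metricDet (x : E4) : ℝ :=
  (gram g x).det

/-- The **inverse metric components** `g^{μν}(x)`: the matrix inverse of `(g_{μν}(x))`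
(`Matrix.inv`; the junk value `0` where the components are degenerate). LL §96 (the `g^{ik}` of
(96.3)). [cite: LandauLifshitz1975, §96 (96.3)] -/
def upper (x : E4) : Matrix (Fin 4) (Fin 4) ℝ :=
  (gram g x)⁻¹

/-- The **gothic (densitised) inverse metric** `𝔤^{μν} = √(−g) g^{μν}` (LL §96, the notation
introduced after (96.9); Blanchet, Living Rev. Relativ., (49): `h^{αβ} = √(−g) g^{αβ} − η^{αβ}`).
`Real.sqrt`, hence the junk value `0` where `g > 0`. [cite: LandauLifshitz1975, §96 (96.9)] -/
def gothic (x : E4) (μ ν : Fin 4) : ℝ :=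
  Real.sqrt (-metricDet g x) * upper g x μ ν

/-! ### The superpotential `H^{μανβ}` and LL's `λ^{iklm}`, `h^{ikl}` -/

/-- The **Landau–Lifshitz superpotential**
`H^{μανβ}(x) = (−g)(g^{μν} g^{αβ} − g^{αν} g^{μβ})`, equal to `𝔤^{μν}𝔤^{αβ} − 𝔤^{αν}𝔤^{μβ}` on
Lorentzian components (`superpotential_eq_gothic`) and to `16π λ^{μνβα}` in the notation (96.3)
of Landau–Lifshitz (`lambdaLL_eq`); index order as in Misner–Thorne–Wheeler (20.21):
antisymmetric in `(μ, α)` and in `(ν, β)`. Arguments: point `x`, then the four indices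
`μ α ν β`. [cite: LandauLifshitz1975, §96 (96.3)] -/
def superpotential (x : E4) (μ α ν β : Fin 4) : ℝ :=
  -metricDet g x * (upper g x μ ν * upper g x α β - upper g x α ν * upper g x μ β)

/-- LL's `λ^{iklm} = (16π)⁻¹ (−g)(g^{ik} g^{lm} − g^{il} g^{km})`, eq. (96.3), with `c = k = 1`.
[cite: LandauLifshitz1975, §96 (96.3)] -/
def lambdaLL (x : E4) (i k l m : Fin 4) : ℝ :=
  (16 * Real.pi)⁻¹ * (-metricDet g x * (upper g x i k * upper g x l m - upper g x i l * upper g x k m))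

/-- LL's **`h^{ikl} = ∂_m λ^{iklm}`**, eq. (96.2), written through the superpotential:
`h^{μνα}(x) = (16π)⁻¹ Σ_β ∂_β H^{μβνα}(x)` (for symmetric components `λ^{μναβ} = (16π)⁻¹ H^{μβνα}`,
`lambdaLL_eq`). Antisymmetric in `(ν, α)` (LL (96.4), `hField_swap`).
[cite: LandauLifshitz1975, §96 (96.2)] -/
def hField (x : E4) (μ ν α : Fin 4) : ℝ :=
  (16 * Real.pi)⁻¹ * ∑ β : Fin 4, partialDeriv β (fun y ↦ superpotential g y μ β ν α) x

/-- The **Landau–Lifshitz energy–momentum complex** `Σ_α ∂_α h^{μνα}(x)`, i.e.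
`(16π)⁻¹ Σ_{αβ} ∂_α ∂_β H^{μανβ}`; by LL (96.5)/(96.7) this is `(−g)(T^{μν} + t^{μν})` with `t` the
pseudotensor (here: by definition of `pseudotensor`, with `T^{μν} = G^{μν}/8π`).
[cite: LandauLifshitz1975, §96 (96.5)] -/
def emComplex (x : E4) (μ ν : Fin 4) : ℝ :=
  ∑ α : Fin 4, partialDeriv α (fun y ↦ hField g y μ ν α) x

/-! ### The Einstein tensor of the components and the pseudotensor `t^{μν}_LL` -/

/-- The Ricci components `R_{αβ}(x) = Ric_x(∂_α, ∂_β)` of the metric components, through the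
coordinate tensor calculus `MetricCoord.ricAt` (O'Neill 1983, Ch. 3, Lemma 3.52; LL (92.6)–(92.7)).
[cite: LandauLifshitz1975, §92 (92.6)] -/
def ricci (x : E4) (α β : Fin 4) : ℝ :=
  MetricCoord.ricAt g x (E4.basisVector α) (E4.basisVector β)

/-- The scalar curvature `R = g^{αβ} R_{αβ}` of the components (LL (92.9)).
[cite: LandauLifshitz1975, §92 (92.9)] -/
def scalar (x : E4) : ℝ :=
  ∑ α : Fin 4, ∑ β : Fin 4, upper g x α β * ricci g x α β

/-- The **contravariant Einstein tensor** `G^{μν} = g^{μα} g^{νβ} (R_{αβ} − ½ R g_{αβ})` of the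
components (LL (95.5)/(96.7): `T^{ik} = (8π)⁻¹ (R^{ik} − ½ g^{ik} R)`).
[cite: LandauLifshitz1975, §96 (96.7)] -/
def einsteinUpper (x : E4) (μ ν : Fin 4) : ℝ :=
  ∑ α : Fin 4, ∑ β : Fin 4,
    upper g x μ α * upper g x ν β * (ricci g x α β - 2⁻¹ * scalar g x * gram g x α β)

/-- The **Landau–Lifshitz energy–momentum pseudotensor** `t^{μν}_LL`, DEFINED as in LL (96.5)–(96.7)
by `(−g)((8π)⁻¹ G^{μν} + t^{μν}) = Σ_α ∂_α h^{μνα}`, i.e.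
`t^{μν} = (−g)⁻¹ Σ_α ∂_α h^{μνα} − (8π)⁻¹ G^{μν}` (junk where `g = 0`). Its explicit quadratic
expressions in `Γ` resp. `∂𝔤` are LL (96.8)/(96.9) (theorems about this definition, not restated).
[cite: LandauLifshitz1975, §96 (96.7)] -/
def pseudotensor (x : E4) (μ ν : Fin 4) : ℝ :=
  (-metricDet g x)⁻¹ * emComplex g x μ ν - (8 * Real.pi)⁻¹ * einsteinUpper g x μ ν

/-! ### Quasi-local four-momentum and momentum flux on coordinate spheres -/

/-- The **quasi-local Landau–Lifshitz four-momentum** of the coordinate ball `|y − ξ| ≤ R` in the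
slice `{x⁰ = t}`, as the SURFACE integral LL (96.16):
`P^μ(t; ξ, R) = ∮_{|y−ξ|=R} Σ_j h^{μ0j}(t, y) (y − ξ)_j / R dσ(y)`
(`= (16π)⁻¹ ∮ Σ_α ∂_α H^{μα0j} n_j dσ`, Misner–Thorne–Wheeler (20.9)), `σ = μHE[2]` the Euclidean
surface measure of `E3` restricted to the coordinate sphere (as in `admEnergyFlux`). Only the metric
near the sphere enters, so it is meaningful with black holes inside. [cite: LandauLifshitz1975, §96 (96.16)] -/
def quasiLocalMomentum (t : ℝ) (ξ : E3) (R : ℝ) (μ : Fin 4) : ℝ :=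
  ∫ y in Metric.sphere ξ R,
    ∑ j : Fin 3, hField g (E4.ofTimeSpace t y) μ 0 j.succ * (y - ξ) j / R ∂(μHE[2] : Measure E3)

/-- The **Landau–Lifshitz momentum flux** through the coordinate sphere:
`Φ^μ(t; ξ, R) = ∮_{|y−ξ|=R} Σ_j (−g) t^{μj}_LL (t, y) (y − ξ)_j / R dσ(y)` — the surface term in
`d/dt ∫_{|y−ξ|≤R} (−g)(T^{μ0} + t^{μ0}) = −∮ (−g)(T^{μj} + t^{μj}) n_j dσ` (LL (96.10)–(96.12)) when
`T = 0` near the sphere. [cite: LandauLifshitz1975, §96 (96.10)–(96.12)] -/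
def momentumFlux (t : ℝ) (ξ : E3) (R : ℝ) (μ : Fin 4) : ℝ :=
  ∫ y in Metric.sphere ξ R,
    ∑ j : Fin 3, -metricDet g (E4.ofTimeSpace t y) * pseudotensor g (E4.ofTimeSpace t y) μ j.succ *
      (y - ξ) j / R ∂(μHE[2] : Measure E3)

/-! ### Algebraic identities -/

variable {g}

/-- For symmetric components the matrix `(g_{μν})` is symmetric. [folklore] -/
theorem gram_transpose {x : E4} (hs : ∀ v w : E4, g x v w = g x w v) : (gram g x)ᵀ = gram g x := by
  ext μ ν
  simp [hs]

/-- For symmetric components the inverse matrix `(g^{μν})` is symmetric: `g^{νμ} = g^{μν}`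
(LL §83). [cite: LandauLifshitz1975, §83] -/
theorem upper_comm {x : E4} (hs : ∀ v w : E4, g x v w = g x w v) (μ ν : Fin 4) :
    upper g x ν μ = upper g x μ ν := by
  have h : (upper g x)ᵀ = upper g x := by
    rw [upper, Matrix.transpose_nonsing_inv, gram_transpose hs]
  conv_lhs => rw [← h]
  rfl

variable (g)

/-- `H` is antisymmetric in its first pair: `H^{αμνβ} = −H^{μανβ}` (identically, for any
components). Misner–Thorne–Wheeler (20.21); LL (96.3). [cite: LandauLifshitz1975, §96 (96.3)] -/
theorem superpotential_swap_left (x : E4) (μ α ν β : Fin 4) :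
    superpotential g x α μ ν β = -superpotential g x μ α ν β := by
  simp only [superpotential]
  ring

/-- `H` is antisymmetric in its second pair: `H^{μαβν} = −H^{μανβ}` (identically). LL (96.3)/(96.4).
[cite: LandauLifshitz1975, §96 (96.4)] -/
theorem superpotential_swap_right (x : E4) (μ α ν β : Fin 4) :
    superpotential g x μ α β ν = -superpotential g x μ α ν β := by
  simp only [superpotential]
  ring

/-- `H^{μμνβ} = 0`. [cite: LandauLifshitz1975, §96 (96.4)] -/
theorem superpotential_self_left (x : E4) (μ ν β : Fin 4) : superpotential g x μ μ ν β = 0 := by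
  simp only [superpotential]
  ring

/-- `H^{μανν} = 0`. [cite: LandauLifshitz1975, §96 (96.4)] -/
theorem superpotential_self_right (x : E4) (μ α ν : Fin 4) : superpotential g x μ α ν ν = 0 := by
  simp only [superpotential]
  ring

variable {g} in
/-- Pair symmetry `H^{νβμα} = H^{μανβ}` for symmetric components. [cite: LandauLifshitz1975, §96 (96.3)] -/
theorem superpotential_pair_comm {x : E4} (hs : ∀ v w : E4, g x v w = g x w v) (μ α ν β : Fin 4) :
    superpotential g x ν β μ α = superpotential g x μ α ν β := by
  simp only [superpotential, upper_comm hs ν μ, upper_comm hs β α, upper_comm hs β μ,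
    upper_comm hs ν α]
  ring

/-- **Gothic form of the superpotential**: where `g ≤ 0` (in particular for Lorentzian components),
`H^{μανβ} = 𝔤^{μν}𝔤^{αβ} − 𝔤^{αν}𝔤^{μβ}` (the form requested by route `EIHFluxBalance`;
Misner–Thorne–Wheeler (20.21)). [cite: LandauLifshitz1975, §96 (96.3)] -/
theorem superpotential_eq_gothic {x : E4} (hx : metricDet g x ≤ 0) (μ α ν β : Fin 4) :
    superpotential g x μ α ν β =
      gothic g x μ ν * gothic g x α β - gothic g x α ν * gothic g x μ β := by
  have h : Real.sqrt (-metricDet g x) * Real.sqrt (-metricDet g x) = -metricDet g x :=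
    Real.mul_self_sqrt (by linarith)
  simp only [superpotential, gothic]
  linear_combination (upper g x μ ν * upper g x α β - upper g x α ν * upper g x μ β) * h.symm

variable {g} in
/-- **`H = 16π λ`**: for symmetric components, `λ^{μναβ} = (16π)⁻¹ H^{μβνα}` — the dictionary
between LL (96.3) and the superpotential. [cite: LandauLifshitz1975, §96 (96.3)] -/
theorem lambdaLL_eq {x : E4} (hs : ∀ v w : E4, g x v w = g x w v) (μ ν α β : Fin 4) :
    lambdaLL g x μ ν α β = (16 * Real.pi)⁻¹ * superpotential g x μ β ν α := by
  simp only [lambdaLL, superpotential, upper_comm hs α β, upper_comm hs ν β]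
  ring

/-- **`h^{μνα}` is antisymmetric in `(ν, α)`** (LL (96.4)), identically: no regularity needed
(`∂(−f) = −∂f` holds also for the junk values). [cite: LandauLifshitz1975, §96 (96.4)] -/
theorem hField_swap (x : E4) (μ ν α : Fin 4) : hField g x μ α ν = -hField g x μ ν α := by
  simp only [hField, partialDeriv]
  rw [← mul_neg, ← Finset.sum_neg_distrib]
  congr 1
  refine Finset.sum_congr rfl fun β _ ↦ ?_
  have h : (fun y ↦ superpotential g y μ β α ν) = fun y ↦ -superpotential g y μ β ν α :=
    funext fun y ↦ superpotential_swap_right g y μ β ν α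
  rw [h, fderiv_fun_neg]
  rfl

/-- `h^{μνν} = 0`; in particular `h^{μ00} = 0`, so only the spatial `h^{μ0j}` enter `P^μ`
(LL, derivation of (96.16)). [cite: LandauLifshitz1975, §96 (96.4)] -/
theorem hField_self (x : E4) (μ ν : Fin 4) : hField g x μ ν ν = 0 := by
  have h := hField_swap g x μ ν ν
  linarith

/-! ### Constant components ("galilean coordinates"): everything vanishes -/

section Const

variable (B : E4 →L[ℝ] E4 →L[ℝ] ℝ)

/-- For constant components the superpotential is constant, so `h^{μνα} = 0`
(LL §96: in galilean coordinates `t^{ik} = 0`). [cite: LandauLifshitz1975, §96] -/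
theorem hField_const (x : E4) (μ ν α : Fin 4) : hField (fun _ ↦ B) x μ ν α = 0 := by
  simp [hField, partialDeriv, superpotential, metricDet, upper, gram]

/-- For constant components the energy–momentum complex vanishes. [cite: LandauLifshitz1975, §96] -/
theorem emComplex_const (x : E4) (μ ν : Fin 4) : emComplex (fun _ ↦ B) x μ ν = 0 := by
  simp only [emComplex, partialDeriv]
  have h : ∀ α : Fin 4, (fun y : E4 ↦ hField (fun _ ↦ B) y μ ν α) = fun _ ↦ (0 : ℝ) :=
    fun α ↦ funext fun y ↦ hField_const B y μ ν α
  simp [h]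

-- instance search on the nested operator spaces needs a deeper pending depth (as in
-- `CoordCurvature.lean`)
set_option maxSynthPendingDepth 3 in
/-- For constant components the Christoffel map of `MetricCoord` vanishes. [folklore] -/
theorem chrAt_const (x : E4) : MetricCoord.chrAt (fun _ : E4 ↦ B) x = 0 := by
  have h : MetricCoord.koszulCLM (fun _ : E4 ↦ B) x = 0 := by
    rw [MetricCoord.koszulCLM, fderiv_const_apply, map_zero]
  simp [MetricCoord.chrAt, h]

/-- For constant components the Ricci components vanish. [folklore] -/
theorem ricci_const (x : E4) (α β : Fin 4) : ricci (fun _ ↦ B) x α β = 0 := by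
  have hchr : MetricCoord.chrAt (fun _ : E4 ↦ B) = fun _ ↦ 0 := funext (chrAt_const B)
  have hriem : ∀ X Y : E4, MetricCoord.riemAt (fun _ : E4 ↦ B) x X Y = 0 := fun X Y ↦ by
    simp [MetricCoord.riemAt, hchr]
  simp only [ricci, MetricCoord.ricAt_apply]
  have : MetricCoord.ricciEndo (fun _ : E4 ↦ B) x (E4.basisVector α) (E4.basisVector β) = 0 := by
    ext X
    simp [hriem]
  rw [this, map_zero]

/-- For constant components the Einstein tensor vanishes. [folklore] -/
theorem einsteinUpper_const (x : E4) (μ ν : Fin 4) : einsteinUpper (fun _ ↦ B) x μ ν = 0 := by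
  simp [einsteinUpper, scalar, ricci_const]

/-- For constant components the pseudotensor vanishes (LL §96: "in the absence of a gravitational
field, in galilean coordinates, `t^{ik} = 0`"). [cite: LandauLifshitz1975, §96] -/
theorem pseudotensor_const (x : E4) (μ ν : Fin 4) : pseudotensor (fun _ ↦ B) x μ ν = 0 := by
  simp [pseudotensor, emComplex_const, einsteinUpper_const]

/-- For constant components every quasi-local momentum vanishes. [cite: LandauLifshitz1975, §96 (96.16)] -/
theorem quasiLocalMomentum_const (t : ℝ) (ξ : E3) (R : ℝ) (μ : Fin 4) :
    quasiLocalMomentum (fun _ ↦ B) t ξ R μ = 0 := by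
  simp [quasiLocalMomentum, hField_const]

/-- For constant components every momentum flux vanishes. [cite: LandauLifshitz1975, §96] -/
theorem momentumFlux_const (t : ℝ) (ξ : E3) (R : ℝ) (μ : Fin 4) :
    momentumFlux (fun _ ↦ B) t ξ R μ = 0 := by
  simp [momentumFlux, pseudotensor_const]

/-- **Minkowski space in inertial coordinates has vanishing Landau–Lifshitz momenta and fluxes**
on every coordinate sphere. [cite: LandauLifshitz1975, §96] -/
theorem quasiLocalMomentum_minkowski (t : ℝ) (ξ : E3) (R : ℝ) (μ : Fin 4) :
    quasiLocalMomentum (fun _ ↦ Minkowski.bilin) t ξ R μ = 0 ∧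
      momentumFlux (fun _ ↦ Minkowski.bilin) t ξ R μ = 0 :=
  ⟨quasiLocalMomentum_const _ t ξ R μ, momentumFlux_const _ t ξ R μ⟩

end Const

/-! ### Minkowski components: `g = −1`, `g^{μν} = η^{μν}`, `H` explicitly -/

/-- The Minkowski components: `(η_{μν}) = diag(−1, 1, 1, 1)`. [cite: LandauLifshitz1975, §96] -/
theorem gram_minkowski (x : E4) :
    gram (fun _ ↦ Minkowski.bilin) x = Matrix.diagonal fun μ : Fin 4 ↦ if μ = 0 then -1 else 1 := by
  ext μ ν
  fin_cases μ <;> fin_cases ν <;>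
    simp [gram, Minkowski.bilin_apply, Fin.sum_univ_three, Matrix.diagonal, E4.basisVector]

/-- `det η = −1`. [cite: LandauLifshitz1975, §96] -/
theorem metricDet_minkowski (x : E4) : metricDet (fun _ ↦ Minkowski.bilin) x = -1 := by
  rw [metricDet, gram_minkowski, Matrix.det_diagonal]
  simp

/-- `(η^{μν}) = diag(−1, 1, 1, 1)`. [cite: LandauLifshitz1975, §96] -/
theorem upper_minkowski (x : E4) :
    upper (fun _ ↦ Minkowski.bilin) x = Matrix.diagonal fun μ : Fin 4 ↦ if μ = 0 then -1 else 1 := by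
  rw [upper, gram_minkowski]
  refine Matrix.inv_eq_left_inv ?_
  rw [Matrix.diagonal_mul_diagonal, ← Matrix.diagonal_one]
  congr 1
  funext μ
  split_ifs <;> norm_num

/-! ### Quasi-local angular four-momentum `M^{μν}` on coordinate spheres (LL (96.13), (96.17)) -/

section AngularMomentum

variable (a : E4)

/-- The **angular-momentum superpotential** of Landau–Lifshitz's derivation of (96.17), with lever
arm measured from the reference event `a ∈ E4`:
`Ψ_a^{μν|λα}(x) = (x − a)^μ h^{νλα}(x) − (x − a)^ν h^{μλα}(x) + λ^{μλαν}(x)`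
(arguments: point `x`, then `μ ν λ α`). LL §96 integrate (96.13) by parts using (96.2), (96.5) and
the identities `λ^{ilkn} − λ^{klin} = λ^{ilnk}`, `λ^{inlk} = −λ^{ilnk}`; this shows that the
angular-momentum complex `(x − a)^μ τ^{νλ} − (x − a)^ν τ^{μλ}` (`amComplex`) is the divergence
`Σ_α ∂_α Ψ_a^{μν|λα}`, whence the surface form (96.17) `M^{ik} = ∮ Ψ^{ik|0α} df_α`. `Ψ` is
antisymmetric in `(λ, α)` identically (`amSuperpotential_swap_right`) and, for symmetric components,
in `(μ, ν)` (`amSuperpotential_swap_left`). LL take `a = 0` (lever arm from the chart origin, §32);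
a general `a` is their formula in the translated chart `x ↦ x − a`, under which `h` and `λ` are
unchanged. [cite: LandauLifshitz1975, §96 (96.17)] -/
def amSuperpotential (x : E4) (μ ν l n : Fin 4) : ℝ :=
  (x - a) μ * hField g x ν l n - (x - a) ν * hField g x μ l n + lambdaLL g x μ l n ν

/-- The **angular-momentum complex** about the event `a`: `(x − a)^μ τ^{νλ}(x) − (x − a)^ν τ^{μλ}(x)`
with `τ^{μν} = Σ_α ∂_α h^{μνα} = (−g)(T^{μν} + t^{μν})` the energy–momentum complex (`emComplex`,
LL (96.5)). Its `λ = 0` components are the density and its spatial components `λ = 1, 2, 3` the flux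
density of angular four-momentum: LL (96.13)
`M^{ik} = ∫ (x^i dP^k − x^k dP^i) = ∫ {x^i (T^{kl} + t^{kl}) − x^k (T^{il} + t^{il})}(−g) dS_l`
(cf. §32, (32.9)–(32.10), for fields in flat space). [cite: LandauLifshitz1975, §96 (96.13)] -/
def amComplex (x : E4) (μ ν l : Fin 4) : ℝ :=
  (x - a) μ * emComplex g x ν l - (x - a) ν * emComplex g x μ l

/-- The **quasi-local Landau–Lifshitz angular four-momentum about the event `a`** of the coordinate
ball `|y − ξ| ≤ R` in the slice `{x⁰ = t}`, as the SUPERPOTENTIAL SURFACE INTEGRAL LL (96.17) (with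
`c = k = 1`):
`M_a^{μν}(t; ξ, R) = ∮_{|y−ξ|=R} Σ_k [(x − a)^μ h^{ν0k} − (x − a)^ν h^{μ0k} + λ^{μ0kν}](x) (y − ξ)_k / R dσ(y)`,
`x = (t, y)` the chart coordinates of the integration point, `σ = μHE[2]` the Euclidean surface
measure (as in `quasiLocalMomentum`, whose integrand `h^{ν0k} n_k` reappears here weighted by the
lever arm). LL print `M^{ik} = (1/c)∮ (x^i h^{k0α} − x^k h^{i0α} + λ^{i0αk}) df_α` with `x^i` the
coordinates themselves, i.e. `a = 0`; `a` only translates the origin of the lever arm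
(`angularMomentumChargeAbout_eq_of_integrableOn`: `M_a = M_b − (a − b)^μ P^ν + (a − b)^ν P^μ`).
Only the metric near the sphere enters (black holes may sit inside). Conventions: `M^{12}` is the
`x¹x²`-component of angular momentum (`= J_z` for matter, `∫ (x dP^y − y dP^x)`), `M^{0k} = (t − a⁰) P^k −
(mass dipole about a)^k`; Misner–Thorne–Wheeler (20.8)–(20.9),
`J^{μν} = (16π)⁻¹ ∮ (x^μ H^{να0j}_{,α} − x^ν H^{μα0j}_{,α} + H^{μj0ν} − H^{νj0μ}) d²S_j` ("about the
origin of coordinates"), is the same integrand: `(16π)⁻¹ H^{να0j}_{,α} = h^{ν0j}` and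
`(16π)⁻¹ (H^{μj0ν} − H^{νj0μ}) = (16π)⁻¹ H^{μν0j} = λ^{μ0jν}` by the cyclic identity of `H`.
For FIXED `a`, `ξ`, `R` the flux law is `d/dt M_a^{μν} = −∮ Σ_k amComplex^{μνk} n_k dσ`
(`angularMomentumFluxAbout`; LL (96.10), (96.13)), for every smooth metric, not proved in this file.
[cite: LandauLifshitz1975, §96 (96.17)] [cite: MisnerThorneWheeler1973, §20.2 (20.8)–(20.9)] -/
def angularMomentumChargeAbout (t : ℝ) (ξ : E3) (R : ℝ) (μ ν : Fin 4) : ℝ :=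
  ∫ y in Metric.sphere ξ R,
    ∑ k : Fin 3, amSuperpotential g a (E4.ofTimeSpace t y) μ ν 0 k.succ * (y - ξ) k / R
      ∂(μHE[2] : Measure E3)

/-- The **flux of angular four-momentum about `a`** through the coordinate sphere:
`Φ_a^{μν}(t; ξ, R) = ∮_{|y−ξ|=R} Σ_k [(x − a)^μ τ^{νk} − (x − a)^ν τ^{μk}](t, y) (y − ξ)_k / R dσ(y)`,
`τ = emComplex = (−g)(T + t)` — the surface term of `d/dt ∫_{|y−ξ|≤R} amComplex^{μν0} d³y =
−∮ amComplex^{μνk} n_k dσ` (LL (96.10) with (96.13); the local conservation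
`Σ_λ ∂_λ amComplex^{μνλ} = τ^{νμ} − τ^{μν} = 0` is the symmetry (96.6)). In vacuum near the sphere
`τ^{μk} = (−g) t^{μk}_LL` (cf. `momentumFlux`). [cite: LandauLifshitz1975, §96 (96.13)] -/
def angularMomentumFluxAbout (t : ℝ) (ξ : E3) (R : ℝ) (μ ν : Fin 4) : ℝ :=
  ∫ y in Metric.sphere ξ R,
    ∑ k : Fin 3, amComplex g a (E4.ofTimeSpace t y) μ ν k.succ * (y - ξ) k / R
      ∂(μHE[2] : Measure E3)

/-- The **quasi-local Landau–Lifshitz angular four-momentum of a coordinate sphere about its own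
centre**: `angularMomentumChargeAbout` with reference event the centre `(t, ξ)` of the sphere in the
slice, so that the lever arm is `x − (t, ξ) = (0, y − ξ)`:
`M^{μν}(t; ξ, R) = ∮_{|y−ξ|=R} Σ_k [(0, y−ξ)^μ h^{ν0k} − (0, y−ξ)^ν h^{μ0k} + λ^{μ0kν}](t, y) (y − ξ)_k / R dσ`
(`angularMomentumCharge_eq`). This is the charge to MATCH against a model hole centred at `ξ`:
`M^{jk}` (`j, k` spatial) is the spin about the centre, and `M^{0k} = −∮ [(y − ξ)_k h^{00j} −
λ^{00jk}] n_j dσ` is minus the LL mass dipole about `ξ` (no `t P^k` term). It is LL (96.17) in the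
chart translated by `(t, ξ)`; relative to a fixed event `a`,
`M^{μν} = M_a^{μν} − ((t, ξ) − a)^μ P^ν + ((t, ξ) − a)^ν P^μ` (`angularMomentumCharge_eq_about`), so
along a slicing its time derivative picks up `−δ^μ_0 P^ν + δ^ν_0 P^μ` in addition to the flux
(the reference event moves with `t`). [cite: LandauLifshitz1975, §96 (96.17)] -/
def angularMomentumCharge (t : ℝ) (ξ : E3) (R : ℝ) (μ ν : Fin 4) : ℝ :=
  angularMomentumChargeAbout g (E4.ofTimeSpace t ξ) t ξ R μ ν

/-- The flux of angular four-momentum through the coordinate sphere about its own centre `(t, ξ)`: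
`angularMomentumFluxAbout` with `a = (t, ξ)`. [cite: LandauLifshitz1975, §96 (96.13)] -/
def angularMomentumFlux (t : ℝ) (ξ : E3) (R : ℝ) (μ ν : Fin 4) : ℝ :=
  angularMomentumFluxAbout g (E4.ofTimeSpace t ξ) t ξ R μ ν

/-! #### Unfolding -/

/-- Unfolding lemma for `angularMomentumChargeAbout`. [cite: LandauLifshitz1975, §96 (96.17)] -/
theorem angularMomentumChargeAbout_def (t : ℝ) (ξ : E3) (R : ℝ) (μ ν : Fin 4) :
    angularMomentumChargeAbout g a t ξ R μ ν = ∫ y in Metric.sphere ξ R,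
      ∑ k : Fin 3, ((E4.ofTimeSpace t y - a) μ * hField g (E4.ofTimeSpace t y) ν 0 k.succ -
        (E4.ofTimeSpace t y - a) ν * hField g (E4.ofTimeSpace t y) μ 0 k.succ +
        lambdaLL g (E4.ofTimeSpace t y) μ 0 k.succ ν) * (y - ξ) k / R ∂(μHE[2] : Measure E3) :=
  rfl

/-- The centred charge with its lever arms `(0, y − ξ)` made explicit.
[cite: LandauLifshitz1975, §96 (96.17)] -/
theorem angularMomentumCharge_eq (t : ℝ) (ξ : E3) (R : ℝ) (μ ν : Fin 4) :
    angularMomentumCharge g t ξ R μ ν = ∫ y in Metric.sphere ξ R,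
      ∑ k : Fin 3, (E4.ofTimeSpace 0 (y - ξ) μ * hField g (E4.ofTimeSpace t y) ν 0 k.succ -
        E4.ofTimeSpace 0 (y - ξ) ν * hField g (E4.ofTimeSpace t y) μ 0 k.succ +
        lambdaLL g (E4.ofTimeSpace t y) μ 0 k.succ ν) * (y - ξ) k / R ∂(μHE[2] : Measure E3) := by
  -- `(t, y) − (t, ξ) = (0, y − ξ)` (cf. `GaussianBeam.ofTimeSpace_sub`, not imported here)
  have h : ∀ y : E3, E4.ofTimeSpace t y - E4.ofTimeSpace t ξ = E4.ofTimeSpace 0 (y - ξ) := fun y ↦ by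
    ext i
    refine Fin.cases ?_ (fun j ↦ ?_) i <;> simp
  simp only [angularMomentumCharge, angularMomentumChargeAbout, amSuperpotential, h]

/-- The centred flux with its lever arms `(0, y − ξ)` made explicit; in particular its `μ = 0` row
is `−∮ Σ_k (y − ξ)_ν… ` free of the time lever arm. [cite: LandauLifshitz1975, §96 (96.13)] -/
theorem angularMomentumFlux_eq (t : ℝ) (ξ : E3) (R : ℝ) (μ ν : Fin 4) :
    angularMomentumFlux g t ξ R μ ν = ∫ y in Metric.sphere ξ R,
      ∑ k : Fin 3, (E4.ofTimeSpace 0 (y - ξ) μ * emComplex g (E4.ofTimeSpace t y) ν k.succ -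
        E4.ofTimeSpace 0 (y - ξ) ν * emComplex g (E4.ofTimeSpace t y) μ k.succ) *
        (y - ξ) k / R ∂(μHE[2] : Measure E3) := by
  have h : ∀ y : E3, E4.ofTimeSpace t y - E4.ofTimeSpace t ξ = E4.ofTimeSpace 0 (y - ξ) := fun y ↦ by
    ext i
    refine Fin.cases ?_ (fun j ↦ ?_) i <;> simp
  simp only [angularMomentumFlux, angularMomentumFluxAbout, amComplex, h]

/-! #### Antisymmetry -/

variable {g} in
/-- LL's identity `λ^{inlk} = −λ^{ilnk}` in the form needed here: `λ^{νλαμ} = −λ^{μλαν}` (swap of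
the outer indices) for symmetric components. [cite: LandauLifshitz1975, §96 (96.17)] -/
theorem lambdaLL_swap_outer {x : E4} (hs : ∀ v w : E4, g x v w = g x w v) (μ l n ν : Fin 4) :
    lambdaLL g x ν l n μ = -lambdaLL g x μ l n ν := by
  simp only [lambdaLL, upper_comm hs l ν, upper_comm hs μ n, upper_comm hs n ν, upper_comm hs μ l]
  ring

/-- `λ^{μαλν} = −λ^{μλαν}` (swap of the inner indices), identically.
[cite: LandauLifshitz1975, §96 (96.3)] -/
theorem lambdaLL_swap_inner (x : E4) (μ l n ν : Fin 4) :
    lambdaLL g x μ n l ν = -lambdaLL g x μ l n ν := by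
  simp only [lambdaLL]
  ring

/-- **`Ψ` is antisymmetric in its last pair** `(λ, α)`, identically (from `h^{νλα} = −h^{ναλ}`,
LL (96.4), and `λ^{μαλν} = −λ^{μλαν}`): the structural fact behind "no interior needed".
[cite: LandauLifshitz1975, §96 (96.4)] -/
theorem amSuperpotential_swap_right (x : E4) (μ ν l n : Fin 4) :
    amSuperpotential g a x μ ν n l = -amSuperpotential g a x μ ν l n := by
  rw [amSuperpotential, amSuperpotential, hField_swap g x ν l n, hField_swap g x μ l n,
    lambdaLL_swap_inner g x μ l n ν]
  ring

/-- `Ψ^{μν|λλ} = 0`; in particular only the spatial `α` contribute to `Ψ^{μν|0α}`.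
[cite: LandauLifshitz1975, §96 (96.4)] -/
theorem amSuperpotential_self_right (x : E4) (μ ν l : Fin 4) :
    amSuperpotential g a x μ ν l l = 0 := by
  have h := amSuperpotential_swap_right g a x μ ν l l
  linarith

variable {g} in
/-- **`Ψ` is antisymmetric in `(μ, ν)`** for symmetric components. [cite: LandauLifshitz1975, §96 (96.17)] -/
theorem amSuperpotential_swap_left {x : E4} (hs : ∀ v w : E4, g x v w = g x w v)
    (μ ν l n : Fin 4) : amSuperpotential g a x ν μ l n = -amSuperpotential g a x μ ν l n := by
  rw [amSuperpotential, amSuperpotential, lambdaLL_swap_outer hs μ l n ν]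
  ring

/-- The angular-momentum complex is antisymmetric in `(μ, ν)`, identically.
[cite: LandauLifshitz1975, §96 (96.13)] -/
theorem amComplex_swap (x : E4) (μ ν l : Fin 4) :
    amComplex g a x ν μ l = -amComplex g a x μ ν l := by
  simp only [amComplex]
  ring

/-- `amComplex^{μμλ} = 0`. [cite: LandauLifshitz1975, §96 (96.13)] -/
theorem amComplex_self (x : E4) (μ l : Fin 4) : amComplex g a x μ μ l = 0 := by
  simp only [amComplex]
  ring

variable {g} in
/-- **`M_a^{νμ} = −M_a^{μν}`**: the quasi-local angular four-momentum is antisymmetric, for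
components symmetric on the sphere (no integrability needed: `∫ −f = −∫ f` unconditionally).
[cite: LandauLifshitz1975, §96 (96.13)] -/
theorem angularMomentumChargeAbout_swap {t : ℝ} {ξ : E3} {R : ℝ}
    (hs : ∀ y ∈ Metric.sphere ξ R, ∀ v w : E4,
      g (E4.ofTimeSpace t y) v w = g (E4.ofTimeSpace t y) w v) (μ ν : Fin 4) :
    angularMomentumChargeAbout g a t ξ R ν μ = -angularMomentumChargeAbout g a t ξ R μ ν := by
  rw [angularMomentumChargeAbout, angularMomentumChargeAbout, ← integral_neg]
  refine setIntegral_congr_fun Metric.isClosed_sphere.measurableSet fun y hy ↦ ?_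
  rw [← Finset.sum_neg_distrib]
  refine Finset.sum_congr rfl fun k _ ↦ ?_
  rw [amSuperpotential_swap_left a (hs y hy)]
  ring

variable {g} in
/-- `M_a^{μμ} = 0` for components symmetric on the sphere. [cite: LandauLifshitz1975, §96 (96.13)] -/
theorem angularMomentumChargeAbout_self {t : ℝ} {ξ : E3} {R : ℝ}
    (hs : ∀ y ∈ Metric.sphere ξ R, ∀ v w : E4,
      g (E4.ofTimeSpace t y) v w = g (E4.ofTimeSpace t y) w v) (μ : Fin 4) :
    angularMomentumChargeAbout g a t ξ R μ μ = 0 := by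
  have h := angularMomentumChargeAbout_swap a hs μ μ
  linarith

/-- **`Φ_a^{νμ} = −Φ_a^{μν}`**, identically. [cite: LandauLifshitz1975, §96 (96.13)] -/
theorem angularMomentumFluxAbout_swap (t : ℝ) (ξ : E3) (R : ℝ) (μ ν : Fin 4) :
    angularMomentumFluxAbout g a t ξ R ν μ = -angularMomentumFluxAbout g a t ξ R μ ν := by
  rw [angularMomentumFluxAbout, angularMomentumFluxAbout, ← integral_neg]
  refine integral_congr_ae (Filter.Eventually.of_forall fun y ↦ ?_)
  dsimp only
  rw [← Finset.sum_neg_distrib]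
  refine Finset.sum_congr rfl fun k _ ↦ ?_
  rw [amComplex_swap]
  ring

variable {g} in
/-- The centred charge is antisymmetric (components symmetric on the sphere).
[cite: LandauLifshitz1975, §96 (96.13)] -/
theorem angularMomentumCharge_swap {t : ℝ} {ξ : E3} {R : ℝ}
    (hs : ∀ y ∈ Metric.sphere ξ R, ∀ v w : E4,
      g (E4.ofTimeSpace t y) v w = g (E4.ofTimeSpace t y) w v) (μ ν : Fin 4) :
    angularMomentumCharge g t ξ R ν μ = -angularMomentumCharge g t ξ R μ ν :=
  angularMomentumChargeAbout_swap _ hs μ ν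

/-- The centred flux is antisymmetric, identically. [cite: LandauLifshitz1975, §96 (96.13)] -/
theorem angularMomentumFlux_swap (t : ℝ) (ξ : E3) (R : ℝ) (μ ν : Fin 4) :
    angularMomentumFlux g t ξ R ν μ = -angularMomentumFlux g t ξ R μ ν :=
  angularMomentumFluxAbout_swap g _ t ξ R μ ν

/-! #### Change of the reference event: `M_a = M_b − (a − b) ∧ P` -/

/-- Pointwise change of reference event: `Ψ_a − Ψ_b = −(a − b)^μ h^{νλα} + (a − b)^ν h^{μλα}`
(the `λ`-term does not see `a`). [cite: LandauLifshitz1975, §96 (96.17)] -/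
theorem amSuperpotential_sub (b x : E4) (μ ν l n : Fin 4) :
    amSuperpotential g a x μ ν l n - amSuperpotential g b x μ ν l n =
      -((a - b) μ * hField g x ν l n) + (a - b) ν * hField g x μ l n := by
  simp only [amSuperpotential, PiLp.sub_apply]
  ring

/-- Pointwise change of reference event for the complex:
`amComplex_a − amComplex_b = −(a − b)^μ τ^{νλ} + (a − b)^ν τ^{μλ}`. [cite: LandauLifshitz1975, §96 (96.13)] -/
theorem amComplex_sub (b x : E4) (μ ν l : Fin 4) :
    amComplex g a x μ ν l - amComplex g b x μ ν l =
      -((a - b) μ * emComplex g x ν l) + (a - b) ν * emComplex g x μ l := by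
  simp only [amComplex, PiLp.sub_apply]
  ring

/-- **Surface measure of coordinate spheres is finite**: `μHE[2] {|y − ξ| = r} < ∞` (translate the
round sphere about the origin, `Literature.MeasureTheory.Hausdorff.euclideanHausdorffMeasure_sphere_lt_top`,
by the isometry `y ↦ y + ξ`). [folklore] -/
theorem euclideanHausdorff_sphere_lt_top (ξ : E3) (r : ℝ) :
    (μHE[2] : Measure E3) (Metric.sphere ξ r) < ⊤ := by
  have hd : Module.finrank ℝ E3 = 2 + 1 := by simp
  have himg : (IsometryEquiv.vaddConst ξ) '' Metric.sphere (0 : E3) r = Metric.sphere ξ r := by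
    rw [IsometryEquiv.image_sphere, IsometryEquiv.vaddConst_apply, zero_vadd]
  rw [← himg, (IsometryEquiv.vaddConst ξ).isometry.euclideanHausdorffMeasure_image]
  exact Literature.MeasureTheory.Hausdorff.euclideanHausdorffMeasure_sphere_lt_top hd r

/-- A function continuous on a coordinate sphere of `E3` is integrable on it against `μHE[2]`
(bounded on a compact set of finite measure). [folklore] -/
theorem integrableOn_sphere_of_continuousOn {F : E3 → ℝ} {ξ : E3} {r : ℝ}
    (hF : ContinuousOn F (Metric.sphere ξ r)) :
    IntegrableOn F (Metric.sphere ξ r) (μHE[2] : Measure E3) := by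
  obtain ⟨C, hC⟩ := (isCompact_sphere ξ r).exists_bound_of_continuousOn hF
  refine IntegrableOn.of_bound (euclideanHausdorff_sphere_lt_top ξ r)
    (hF.aestronglyMeasurable Metric.isClosed_sphere.measurableSet) C ?_
  exact (ae_restrict_iff' Metric.isClosed_sphere.measurableSet).2 (ae_of_all _ hC)

/-- `∫ (A − c B + d C) = ∫ A − c ∫ B + d ∫ C` on a set, for integrable `A, B, C`. [folklore] -/
theorem setIntegral_sub_mul_add_mul {s : Set E3} {A B C : E3 → ℝ} {c d : ℝ}
    (hA : IntegrableOn A s (μHE[2] : Measure E3)) (hB : IntegrableOn B s (μHE[2] : Measure E3))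
    (hC : IntegrableOn C s (μHE[2] : Measure E3)) :
    ∫ y in s, (A y - c * B y + d * C y) ∂(μHE[2] : Measure E3) =
      ∫ y in s, A y ∂(μHE[2] : Measure E3) - c * ∫ y in s, B y ∂(μHE[2] : Measure E3) +
        d * ∫ y in s, C y ∂(μHE[2] : Measure E3) := by
  rw [integral_add (hA.sub' (hB.const_mul c)) (hC.const_mul d), integral_sub hA (hB.const_mul c),
    integral_const_mul, integral_const_mul]

variable {g} in
/-- **Change of the reference event** (LL (96.13) with `x ↦ x − a`: `M_a^{ik} = M^{ik} − a^i P^k +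
a^k P^i`, here between two arbitrary events and at the level of the surface integrals (96.16)–(96.17)):
`M_a^{μν} = M_b^{μν} − (a − b)^μ P^ν + (a − b)^ν P^μ`, provided the two momentum integrands
`Σ_k h^{κ0k} n_k` (`κ = μ, ν`) and the integrand of `M_b` are integrable on the sphere.
[cite: LandauLifshitz1975, §96 (96.13)] -/
theorem angularMomentumChargeAbout_eq_of_integrableOn (b : E4) {t : ℝ} {ξ : E3} {R : ℝ}
    {μ ν : Fin 4}
    (hμ : IntegrableOn (fun y ↦ ∑ k : Fin 3,
      hField g (E4.ofTimeSpace t y) μ 0 k.succ * (y - ξ) k / R) (Metric.sphere ξ R) μHE[2])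
    (hν : IntegrableOn (fun y ↦ ∑ k : Fin 3,
      hField g (E4.ofTimeSpace t y) ν 0 k.succ * (y - ξ) k / R) (Metric.sphere ξ R) μHE[2])
    (hb : IntegrableOn (fun y ↦ ∑ k : Fin 3,
      amSuperpotential g b (E4.ofTimeSpace t y) μ ν 0 k.succ * (y - ξ) k / R)
      (Metric.sphere ξ R) μHE[2]) :
    angularMomentumChargeAbout g a t ξ R μ ν =
      angularMomentumChargeAbout g b t ξ R μ ν - (a - b) μ * quasiLocalMomentum g t ξ R ν +
        (a - b) ν * quasiLocalMomentum g t ξ R μ := by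
  have hpt : ∀ y : E3,
      ∑ k : Fin 3, amSuperpotential g a (E4.ofTimeSpace t y) μ ν 0 k.succ * (y - ξ) k / R =
        ∑ k : Fin 3, amSuperpotential g b (E4.ofTimeSpace t y) μ ν 0 k.succ * (y - ξ) k / R -
          (a - b) μ * ∑ k : Fin 3, hField g (E4.ofTimeSpace t y) ν 0 k.succ * (y - ξ) k / R +
          (a - b) ν * ∑ k : Fin 3, hField g (E4.ofTimeSpace t y) μ 0 k.succ * (y - ξ) k / R := by
    intro y
    rw [Finset.mul_sum, Finset.mul_sum, ← Finset.sum_sub_distrib, ← Finset.sum_add_distrib]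
    refine Finset.sum_congr rfl fun k _ ↦ ?_
    have h := amSuperpotential_sub g a b (E4.ofTimeSpace t y) μ ν 0 k.succ
    have h' : amSuperpotential g a (E4.ofTimeSpace t y) μ ν 0 k.succ =
        amSuperpotential g b (E4.ofTimeSpace t y) μ ν 0 k.succ -
          (a - b) μ * hField g (E4.ofTimeSpace t y) ν 0 k.succ +
          (a - b) ν * hField g (E4.ofTimeSpace t y) μ 0 k.succ := by linarith
    rw [h']
    ring
  simp only [angularMomentumChargeAbout, quasiLocalMomentum, hpt]
  exact setIntegral_sub_mul_add_mul hb hν hμ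

variable {g} in
/-- **Change of the reference event, continuous integrands**: if `y ↦ h^{κ0k}(t, y)` (`κ = μ, ν`)
and `y ↦ λ^{μ0kν}(t, y)` are continuous on the sphere (e.g. the components are `C²` and
nondegenerate near it), then `M_a^{μν} = M_b^{μν} − (a − b)^μ P^ν + (a − b)^ν P^μ`.
[cite: LandauLifshitz1975, §96 (96.13)] -/
theorem angularMomentumChargeAbout_eq_of_continuousOn (b : E4) {t : ℝ} {ξ : E3} {R : ℝ}
    {μ ν : Fin 4}
    (hμ : ∀ k : Fin 3, ContinuousOn (fun y ↦ hField g (E4.ofTimeSpace t y) μ 0 k.succ)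
      (Metric.sphere ξ R))
    (hν : ∀ k : Fin 3, ContinuousOn (fun y ↦ hField g (E4.ofTimeSpace t y) ν 0 k.succ)
      (Metric.sphere ξ R))
    (hl : ∀ k : Fin 3, ContinuousOn (fun y ↦ lambdaLL g (E4.ofTimeSpace t y) μ 0 k.succ ν)
      (Metric.sphere ξ R)) :
    angularMomentumChargeAbout g a t ξ R μ ν =
      angularMomentumChargeAbout g b t ξ R μ ν - (a - b) μ * quasiLocalMomentum g t ξ R ν +
        (a - b) ν * quasiLocalMomentum g t ξ R μ := by
  have hsub : Continuous fun y : E3 ↦ y - ξ := continuous_id.sub continuous_const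
  have hn : ∀ k : Fin 3, ContinuousOn (fun y : E3 ↦ (y - ξ) k / R) (Metric.sphere ξ R) := fun k ↦
    (((PiLp.continuous_apply 2 (fun _ : Fin 3 ↦ ℝ) k).comp hsub).div_const R).continuousOn
  have hxb : Continuous fun y : E3 ↦ E4.ofTimeSpace t y - b :=
    (E4.continuous_ofTimeSpace t).sub continuous_const
  have hx : ∀ κ : Fin 4, ContinuousOn (fun y : E3 ↦ (E4.ofTimeSpace t y - b) κ)
      (Metric.sphere ξ R) := fun κ ↦
    ((PiLp.continuous_apply 2 (fun _ : Fin 4 ↦ ℝ) κ).comp hxb).continuousOn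
  refine angularMomentumChargeAbout_eq_of_integrableOn a b
    (integrableOn_sphere_of_continuousOn (continuousOn_finsetSum _ fun k _ ↦ ?_))
    (integrableOn_sphere_of_continuousOn (continuousOn_finsetSum _ fun k _ ↦ ?_))
    (integrableOn_sphere_of_continuousOn (continuousOn_finsetSum _ fun k _ ↦ ?_))
  · simpa only [mul_div_assoc, Pi.mul_def] using (hμ k).mul (hn k)
  · simpa only [mul_div_assoc, Pi.mul_def] using (hν k).mul (hn k)
  · simpa only [amSuperpotential, mul_div_assoc, Pi.mul_def, Pi.sub_def, Pi.add_def] using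
      ((((hx μ).mul (hν k)).sub ((hx ν).mul (hμ k))).add (hl k)).mul (hn k)

variable {g} in
/-- **The centred charge from the charge about a fixed event**:
`M^{μν}(t; ξ, R) = M_a^{μν}(t; ξ, R) − ((t, ξ) − a)^μ P^ν + ((t, ξ) − a)^ν P^μ` (continuous
integrands). With `a` fixed this is the dictionary used to transport the flux law of `M_a` to the
co-moving charge. [cite: LandauLifshitz1975, §96 (96.13)] -/
theorem angularMomentumCharge_eq_about {t : ℝ} {ξ : E3} {R : ℝ} {μ ν : Fin 4}
    (hμ : ∀ k : Fin 3, ContinuousOn (fun y ↦ hField g (E4.ofTimeSpace t y) μ 0 k.succ)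
      (Metric.sphere ξ R))
    (hν : ∀ k : Fin 3, ContinuousOn (fun y ↦ hField g (E4.ofTimeSpace t y) ν 0 k.succ)
      (Metric.sphere ξ R))
    (hl : ∀ k : Fin 3, ContinuousOn (fun y ↦ lambdaLL g (E4.ofTimeSpace t y) μ 0 k.succ ν)
      (Metric.sphere ξ R)) :
    angularMomentumCharge g t ξ R μ ν =
      angularMomentumChargeAbout g a t ξ R μ ν - (E4.ofTimeSpace t ξ - a) μ * quasiLocalMomentum g t ξ R ν +
        (E4.ofTimeSpace t ξ - a) ν * quasiLocalMomentum g t ξ R μ :=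
  angularMomentumChargeAbout_eq_of_continuousOn _ a hμ hν hl

/-! #### Odd integrands on spheres; constant components -/

/-- **An integrand odd under the point reflection through the centre has zero sphere integral**:
if `F(2ξ − y) = −F(y)` then `∮_{|y−ξ|=r} F dμHE[2] = 0` (the reflection is an isometry fixing the
sphere, and `μHE[2]` is isometry invariant). [folklore] -/
theorem setIntegral_sphere_eq_zero_of_odd {F : E3 → ℝ} {ξ : E3} {r : ℝ}
    (hF : ∀ y, F (AffineIsometryEquiv.pointReflection ℝ ξ y) = -F y) :
    ∫ y in Metric.sphere ξ r, F y ∂(μHE[2] : Measure E3) = 0 := by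
  set σ := AffineIsometryEquiv.pointReflection ℝ ξ with hσ
  have hmp : MeasurePreserving σ.toIsometryEquiv (μHE[2] : Measure E3) (μHE[2] : Measure E3) :=
    σ.toIsometryEquiv.measurePreserving_euclideanHausdorffMeasure 2
  have hme : MeasurableEmbedding σ.toIsometryEquiv :=
    σ.toIsometryEquiv.toHomeomorph.measurableEmbedding
  have hpre : σ.toIsometryEquiv ⁻¹' Metric.sphere ξ r = Metric.sphere ξ r := by
    ext y
    simp only [Set.mem_preimage, Metric.mem_sphere, AffineIsometryEquiv.coe_toIsometryEquiv, hσ,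
      AffineIsometryEquiv.dist_pointReflection_fixed]
  have h := hmp.setIntegral_preimage_emb hme F (Metric.sphere ξ r)
  rw [hpre] at h
  simp only [AffineIsometryEquiv.coe_toIsometryEquiv, hσ] at h
  have h' : ∫ y in Metric.sphere ξ r, F (AffineIsometryEquiv.pointReflection ℝ ξ y)
      ∂(μHE[2] : Measure E3) = -∫ y in Metric.sphere ξ r, F y ∂(μHE[2] : Measure E3) := by
    rw [← integral_neg]
    exact integral_congr_ae (Filter.Eventually.of_forall fun y ↦ hF y)
  linarith

/-- The components of the outward normal integrate to zero over a coordinate sphere: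
`∮_{|y−ξ|=r} (y − ξ)_k dμHE[2] = 0`. [folklore] -/
theorem setIntegral_sphere_sub_apply (ξ : E3) (r : ℝ) (k : Fin 3) :
    ∫ y in Metric.sphere ξ r, (y - ξ) k ∂(μHE[2] : Measure E3) = 0 := by
  refine setIntegral_sphere_eq_zero_of_odd fun y ↦ ?_
  simp only [AffineIsometryEquiv.pointReflection_apply, vsub_eq_sub, vadd_eq_add, PiLp.sub_apply,
    PiLp.add_apply]
  ring

section Const

variable (B : E4 →L[ℝ] E4 →L[ℝ] ℝ)

/-- For constant components `λ` is constant. [cite: LandauLifshitz1975, §96 (96.3)] -/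
theorem lambdaLL_const (x y : E4) (i k l m : Fin 4) :
    lambdaLL (fun _ ↦ B) x i k l m = lambdaLL (fun _ ↦ B) y i k l m := rfl

/-- For constant components `Ψ_a` reduces to the (constant) `λ`-term. [cite: LandauLifshitz1975, §96] -/
theorem amSuperpotential_const (x : E4) (μ ν l n : Fin 4) :
    amSuperpotential (fun _ ↦ B) a x μ ν l n = lambdaLL (fun _ ↦ B) x μ l n ν := by
  simp [amSuperpotential, hField_const]

/-- For constant components the angular-momentum complex vanishes. [cite: LandauLifshitz1975, §96] -/
theorem amComplex_const (x : E4) (μ ν l : Fin 4) : amComplex (fun _ ↦ B) a x μ ν l = 0 := by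
  simp [amComplex, emComplex_const]

/-- **For constant components every quasi-local angular four-momentum vanishes** (the `λ`-term is a
constant vector dotted into the normal, whose sphere integral is zero by reflection symmetry; LL §96:
no field in galilean coordinates). [cite: LandauLifshitz1975, §96 (96.17)] -/
theorem angularMomentumChargeAbout_const (t : ℝ) (ξ : E3) (R : ℝ) (μ ν : Fin 4) :
    angularMomentumChargeAbout (fun _ ↦ B) a t ξ R μ ν = 0 := by
  rw [angularMomentumChargeAbout]
  refine setIntegral_sphere_eq_zero_of_odd fun y ↦ ?_
  simp only [amSuperpotential_const, ← Finset.sum_neg_distrib]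
  refine Finset.sum_congr rfl fun k _ ↦ ?_
  rw [lambdaLL_const B (E4.ofTimeSpace t (AffineIsometryEquiv.pointReflection ℝ ξ y))
    (E4.ofTimeSpace t y)]
  simp only [AffineIsometryEquiv.pointReflection_apply, vsub_eq_sub, vadd_eq_add, PiLp.sub_apply,
    PiLp.add_apply]
  ring

/-- For constant components every angular-momentum flux vanishes. [cite: LandauLifshitz1975, §96] -/
theorem angularMomentumFluxAbout_const (t : ℝ) (ξ : E3) (R : ℝ) (μ ν : Fin 4) :
    angularMomentumFluxAbout (fun _ ↦ B) a t ξ R μ ν = 0 := by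
  simp [angularMomentumFluxAbout, amComplex_const]

/-- For constant components the centred charge and flux vanish. [cite: LandauLifshitz1975, §96] -/
theorem angularMomentumCharge_const (t : ℝ) (ξ : E3) (R : ℝ) (μ ν : Fin 4) :
    angularMomentumCharge (fun _ ↦ B) t ξ R μ ν = 0 ∧ angularMomentumFlux (fun _ ↦ B) t ξ R μ ν = 0 :=
  ⟨angularMomentumChargeAbout_const _ B t ξ R μ ν, angularMomentumFluxAbout_const _ B t ξ R μ ν⟩

/-- **Minkowski space in inertial coordinates has vanishing Landau–Lifshitz angular four-momentum
and flux** on every coordinate sphere, about every event. [cite: LandauLifshitz1975, §96] -/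
theorem angularMomentumChargeAbout_minkowski (t : ℝ) (ξ : E3) (R : ℝ) (μ ν : Fin 4) :
    angularMomentumChargeAbout (fun _ ↦ Minkowski.bilin) a t ξ R μ ν = 0 ∧
      angularMomentumFluxAbout (fun _ ↦ Minkowski.bilin) a t ξ R μ ν = 0 :=
  ⟨angularMomentumChargeAbout_const a _ t ξ R μ ν, angularMomentumFluxAbout_const a _ t ξ R μ ν⟩

end Const

end AngularMomentum


end LandauLifshitz

end Literature.Geometry.Lorentzian

end
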